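import Summits.HodgeConjecture.CorCM.MultiFieldWeilThreePerFieldFamilies
import Summits.HodgeConjecture.CorCM.MultiFieldWeilQuadraticSexticClosures
import Summits.HodgeConjecture.CorCM.MultiFieldWeilIsolatedPairBlock
import HarnessLib

/-!
# MULTI-FIELD WEIL ENGINE — TWO CLASSES PER ISOLATED FIELD: simple CM abelian varieties of dimension `≤ 3` in which two non-isogenous threefolds may carry ISOMORPHIC sextic CM
# fields WITH an imaginary quadratic subfield provided that field is ISOLATED — the Hodge conjecture for every product of copies, given ONLY Markman's fourfold theorem

Cell `pub-hodgecm2` (COR-CM), seat b30 gen 37 (2026-08-25); count-neutral own lane MULTI-FIELD WEIL ENGINE (stem `MultiFieldWeil*`).  Theorems only; no definition, no named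
fact, no `sorry`.  HONEST FRAMING: conditional ONLY on `Markman2025_weilClasses_algebraic_abelianFourfold`; `HC_CM` is NOT proved and not asserted.
**`hodgeConjectureFor_prod_of_twoPerIsolatedField_of_markman`**: `A_i ⊨ (K_i; Φ_i)` (`i ∈ I` finite) SIMPLE of dimension `≤ 3`, sextic slots pairwise NON-ISOGENOUS, with
(A₂) two distinct sextic slots `t, t′` whose fields SHARE an imaginary quadratic field have NON-ISOMORPHIC fields — UNLESS the pair is ISOLATED: no third sextic slot shares an
imaginary quadratic field with `K_t` or has the Galois closure of `K_t` (then `K_t ≃ K_{t′}` is allowed: TWO TYPES OF ONE FIELD `k·F⁺`); (B″) at most THREE sextic slots per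
isomorphism class of fields; (iii′) among three quartic slots with one closure two carry isogenous surfaces ⟹ HC for EVERY product of copies `⨁_j A_{π j}`.  This extends
`CorCM/MultiFieldWeilClassesPerFieldFamilies.lean` ((A): sharing ⟹ non-isomorphic, always) by the isolated pairs.  PROOF = that of `CorCM/MultiFieldWeilThreePerFieldFamilies.lean`
(blocks: classes of «isomorphic fields or sharing» + the surface block; additivity by the support census `CorCM/MultiFieldWeilJointlyOntoGluing.lean`) with two changes: a support
set `J` meeting two blocks cannot contain both members of an isolated pair (its partner of another block would have their closure); and a k-group containing an isomorphic pair IS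
that pair (isolation), whose block — the pair and the CM elliptic curves through `k` — is the PAIR BLOCK `hodgeConjectureFor_prod_pairBlock_of_markman`
(`CorCM/MultiFieldWeilIsolatedPairBlock.lean`); a k-group without isomorphic pair is W2's group block as before.  HONEST LIMITS: an isomorphic has-k pair TOGETHER with a
third threefold through the same imaginary quadratic field or in the same Galois closure (e.g. over the sister field `k′·F⁺`: blocks NOT additive); three classes of one `k·F⁺`;
four classes of one field; the dihedral surface triple. [cite: MoonenZarhin1999LowDim, Thm. (0.1), Thm. (0.2), §3 (3.1), Cor. (3.9)] [cite: Markman2025SurveySecant, Thm. 1.2]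
[cite: Gordon1999HodgeAVSurvey, §3 Theorem (proof), 7.4–7.7, 9.4] [cite: Shimura1998, §5.2, §8.1, §8.4] [cite: Lang2002, I §6 Thm. 6.4 (ii); VI §1 Thm. 1.1] [cite: MumfordAV1970, §19]
-/

noncomputable section

open CategoryTheory CategoryTheory.Limits NumberField IntermediateField

namespace Summit.HodgeConjecture.CorCM.MultiFieldWeil

open Finset Literature.NumberTheory.ComplexMultiplication
open Literature.AlgebraicGeometry Literature.AlgebraicGeometry.Motives Literature.AlgebraicGeometry.HodgeTheory
open Literature.AlgebraicGeometry.ComplexMultiplication (IsCMTypeRealisation exists_ringEquiv_forall_mem_iff_of_isIsogenous)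
open Literature.AlgebraicTopology.SingularHomology Literature.AlgebraicGeometry.Pohlmann1968

open scoped Classical

variable {I : Type} {K : I → Type} [∀ i, Field (K i)] [∀ i, NumberField (K i)] [∀ i, IsCMField (K i)]
  {Φ : ∀ i, CMType (K i)} {A : I → AbelianVariety ℂ} {ι : ∀ i, 𝓞 (K i) →+* End (A i)} {θ : ∀ i, K i →+* Module.End ℂ (complexBetti (A i).X 1)}

omit [∀ i, IsCMField (K i)] in
/-- The CM field of a realisation of dimension `≤ 3` has degree `2`, `4` or `6`. [cite: Shimura1998, §5.2] -/
private theorem finrank_eq_or_of_dim_le_three₃₇d (hA : ∀ i, IsCMTypeRealisation (Φ i) (A i) (ι i) (θ i)) {i : I} (h3 : (A i).dim ≤ 3) :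
    Module.finrank ℚ (K i) = 2 ∨ Module.finrank ℚ (K i) = 4 ∨ Module.finrank ℚ (K i) = 6 := by
  have h := finrank_eq_two_mul_dim_of_isCMTypeRealisation (hA i); have hpos : 0 < Module.finrank ℚ (K i) := Module.finrank_pos
  interval_cases hd : (A i).dim <;> omega

omit [∀ i, IsCMField (K i)] in
/-- An embedding of number fields `K_i ↪ K_t` makes `[K_i : ℚ]` divide `[K_t : ℚ]`. [cite: Shimura1998, §8.1] -/
private theorem finrank_dvd_of_ringHom₃₇d {i t : I} (g : K i →+* K t) : Module.finrank ℚ (K i) ∣ Module.finrank ℚ (K t) := by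
  have h1 : Module.finrank ℚ ↥g.toRatAlgHom.fieldRange = Module.finrank ℚ (K i) :=
    ((AlgEquiv.ofInjectiveField g.toRatAlgHom).toLinearEquiv.finrank_eq).symm
  rw [← h1, ← IntermediateField.finrank_top' (F := ℚ) (E := K t)]
  exact IntermediateField.finrank_dvd_of_le_right le_top

/-- **MAIN THEOREM — TWO PER ISOLATED FIELD.**  `A_i ⊨ (K_i; Φ_i)` (`i ∈ I` finite) SIMPLE of dimension `≤ 3`, sextic slots pairwise non-isogenous, such that (A₂) two
distinct sextic slots `t, t′` whose fields share an imaginary quadratic field have non-isomorphic fields UNLESS no third sextic slot shares an imaginary quadratic field with `K_t`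
or has the Galois closure of `K_t`, (B″) at most three sextic slots have fields isomorphic to a given one, (iii′) among three quartic slots with one Galois closure two carry
isogenous surfaces.  Then the Hodge conjecture holds for EVERY product of copies `⨁_j A_{π j}`, GIVEN ONLY Markman's fourfold theorem.  `HC_CM` is NOT asserted.
[cite: MoonenZarhin1999LowDim, Thm. (0.1), Thm. (0.2), §3 (3.1), Cor. (3.9)] [cite: Markman2025SurveySecant, Thm. 1.2] [cite: Gordon1999HodgeAVSurvey, §3 Theorem (proof), 7.4–7.7, 9.4]
[cite: Dodson1984, §5.1.2 Theorem] [cite: Lang2002, I §6 Thm. 6.4 (ii); VI §1 Thm. 1.1] -/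
theorem hodgeConjectureFor_prod_of_twoPerIsolatedField_of_markman [Fintype I] (hW4 : Markman2025_weilClasses_algebraic_abelianFourfold)
    (hA : ∀ i, IsCMTypeRealisation (Φ i) (A i) (ι i) (θ i)) (hS : ∀ i, (A i).IsSimple) (h3 : ∀ i, (A i).dim ≤ 3)
    (hQ : ∀ t t' : I, t ≠ t' → Module.finrank ℚ (K t) = 6 → Module.finrank ℚ (K t') = 6 →
      (∃ F : IntermediateField ℚ (K t), Module.finrank ℚ F = 2 ∧ IsTotallyComplex F ∧ Nonempty (F →+* K t')) → IsEmpty (K t' ≃+* K t) ∨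
        ∀ t'' : I, Module.finrank ℚ (K t'') = 6 → t'' ≠ t → t'' ≠ t' →
          (¬ ∃ F : IntermediateField ℚ (K t), Module.finrank ℚ F = 2 ∧ IsTotallyComplex F ∧ Nonempty (F →+* K t'')) ∧ normalClosure ℚ (K t'') ℂ ≠ normalClosure ℚ (K t) ℂ)
    (hN : ∀ t t' : I, t ≠ t' → Module.finrank ℚ (K t) = 6 → Module.finrank ℚ (K t') = 6 → ¬ AbelianVariety.IsIsogenous (A t) (A t'))
    (hB3 : ∀ t : I, Module.finrank ℚ (K t) = 6 → (Finset.univ.filter fun t' => Nonempty (K t' ≃+* K t)).card ≤ 3)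
    (hS3 : ∀ x y z : I, Module.finrank ℚ (K x) = 4 → Module.finrank ℚ (K y) = 4 → Module.finrank ℚ (K z) = 4 →
      normalClosure ℚ (K x) ℂ = normalClosure ℚ (K y) ℂ → normalClosure ℚ (K y) ℂ = normalClosure ℚ (K z) ℂ →
      AbelianVariety.IsIsogenous (A x) (A y) ∨ AbelianVariety.IsIsogenous (A x) (A z) ∨ AbelianVariety.IsIsogenous (A y) (A z))
    {N : ℕ} (π : Fin N → I) : HodgeConjectureFor (⨁ fun j => A (π j)).dim (⨁ fun j => A (π j)).X := by
  classical
  let Sh : I → I → Prop := fun t t' => ∃ F : IntermediateField ℚ (K t), Module.finrank ℚ F = 2 ∧ IsTotallyComplex F ∧ Nonempty (F →+* K t')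
  let R : I → I → Prop := fun t t' => Module.finrank ℚ (K t) = 6 ∧ Module.finrank ℚ (K t') = 6 ∧ (Nonempty (K t →+* K t') ∨ Sh t t')
  have h46 : ∀ t, Module.finrank ℚ (K t) = 6 → ¬ 4 ∣ Module.finrank ℚ (K t) := fun t ht => by rw [ht]; decide
  have hRrefl : ∀ t, Module.finrank ℚ (K t) = 6 → R t t := fun t ht => ⟨ht, ht, Or.inl ⟨RingHom.id _⟩⟩
  have hRsymm : ∀ t t', R t t' → R t' t := by
    rintro t t' ⟨ht, ht', hg | hsh⟩
    · obtain ⟨g⟩ := hg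
      exact ⟨ht', ht, Or.inl (nonempty_ringHom_symm_of_finrank_eq g (ht.trans ht'.symm))⟩
    · exact ⟨ht', ht, Or.inr (sharedQuadratic_symm hsh)⟩
  have hRtrans : ∀ t t' t'', R t t' → R t' t'' → R t t'' := by
    rintro t t' t'' ⟨ht, ht', h₁⟩ ⟨-, ht'', h₂⟩
    refine ⟨ht, ht'', ?_⟩
    rcases h₁ with hg | hsh
    · obtain ⟨g⟩ := hg
      rcases h₂ with hg' | hsh'
      · obtain ⟨g'⟩ := hg'
        exact Or.inl ⟨g'.comp g⟩
      · -- `K_t ≅ K_{t'}` shares what `K_{t'}` shares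
        obtain ⟨gi⟩ := nonempty_ringHom_symm_of_finrank_eq g (ht.trans ht'.symm)
        exact Or.inr (sharedQuadratic_of_ringHom_left gi hsh')
    · rcases h₂ with hg' | hsh'
      · obtain ⟨g'⟩ := hg'
        obtain ⟨F, hF2, hFtc, hf⟩ := hsh
        obtain ⟨f⟩ := hf
        exact Or.inr ⟨F, hF2, hFtc, ⟨g'.comp f⟩⟩
      · exact Or.inr (sharedQuadratic_trans (h46 t' ht') hsh hsh')
  have hL_of_hom : ∀ {t t'}, Module.finrank ℚ (K t) = 6 → Module.finrank ℚ (K t') = 6 → Nonempty (K t →+* K t') →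
      normalClosure ℚ (K t) ℂ = normalClosure ℚ (K t') ℂ := fun ht ht' ⟨g⟩ => normalClosure_eq_of_ringHom_of_finrank_eq g (ht.trans ht'.symm)
  let cls : I → Finset I := fun t => Finset.univ.filter (R t)
  have hcls : ∀ t t', Module.finrank ℚ (K t) = 6 → (cls t = cls t' ↔ R t t') := by
    intro t t' ht
    refine ⟨fun h => ?_, fun h => ?_⟩
    · have htt : t ∈ cls t' := by rw [← h]; exact Finset.mem_filter.2 ⟨Finset.mem_univ _, hRrefl t ht⟩
      exact hRsymm _ _ (Finset.mem_filter.1 htt).2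
    · ext x
      simp only [cls, Finset.mem_filter, Finset.mem_univ, true_and]
      exact ⟨fun hx => hRtrans _ _ _ (hRsymm _ _ h) hx, fun hx => hRtrans _ _ _ h hx⟩
  let lab : I → Option (Finset I) := fun i => if h : ∃ t, Module.finrank ℚ (K t) = 6 ∧ Nonempty (K i →+* K t) then some (cls (Classical.choose h)) else none
  have hlab : ∀ i t, Module.finrank ℚ (K t) = 6 → Nonempty (K i →+* K t) → lab i = some (cls t) := by
    intro i t ht hg
    have h : ∃ t, Module.finrank ℚ (K t) = 6 ∧ Nonempty (K i →+* K t) := ⟨t, ht, hg⟩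
    obtain ⟨ht₀, ⟨g₀⟩⟩ := Classical.choose_spec h
    obtain ⟨g⟩ := hg
    have hlabi : lab i = some (cls (Classical.choose h)) := by simp only [lab, dif_pos h]
    rw [hlabi, Option.some.injEq, hcls _ _ ht₀]
    -- `R t₀ t`: the slot `i` is a curve through both fields, or a sextic slot isomorphic to both
    rcases finrank_eq_or_of_dim_le_three₃₇d hA (h3 i) with h2 | h4 | h6
    · exact ⟨ht₀, ht, Or.inr (exists_quadratic_subfield_of_ringHom_ringHom (k := K i) h2 g₀ g)⟩
    · exfalso
      have hd := finrank_dvd_of_ringHom₃₇d g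
      rw [h4, ht] at hd
      omega
    · obtain ⟨g₀'⟩ := nonempty_ringHom_symm_of_finrank_eq g₀ (h6.trans ht₀.symm)
      exact ⟨ht₀, ht, Or.inl ⟨g.comp g₀'⟩⟩
  have hlab6 : ∀ t, Module.finrank ℚ (K t) = 6 → lab t = some (cls t) := fun t ht => hlab t t ht ⟨RingHom.id _⟩
  have hlab_none : ∀ i, (¬ ∃ t, Module.finrank ℚ (K t) = 6 ∧ Nonempty (K i →+* K t)) → lab i = none := fun i h => by simp only [lab, dif_neg h]
  let D : Type := {o : Option (Finset I) // ∃ i, lab i = o}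
  let κ : I → D := fun i => ⟨lab i, i, rfl⟩
  have hκ : Function.Surjective κ := by
    rintro ⟨o, i, rfl⟩
    exact ⟨i, rfl⟩
  have hκne : ∀ i j, κ i ≠ κ j ↔ lab i ≠ lab j := fun i j =>
    ⟨fun h h' => h (Subtype.ext h'), fun h h' => h (congrArg Subtype.val h')⟩
  have hnotR : ∀ i j, lab i ≠ lab j → Module.finrank ℚ (K i) = 6 → Module.finrank ℚ (K j) = 6 → ¬ R i j := fun i j hne hi hj hR =>
    hne (by rw [hlab6 i hi, hlab6 j hj, (hcls i j hi).2 hR])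
  have hcurve : ∀ a j, lab a ≠ lab j → Module.finrank ℚ (K a) = 2 → Module.finrank ℚ (K j) = 6 → IsEmpty (K a →+* K j) := fun a j hne h2 hj =>
    ⟨fun g => hne ((hlab a j hj ⟨g⟩).trans (hlab6 j hj).symm)⟩
  have hpair : ∀ i j, lab i ≠ lab j → ¬ (Module.finrank ℚ (K i) = 6 ∧ Module.finrank ℚ (K j) = 6 ∧ normalClosure ℚ (K i) ℂ = normalClosure ℚ (K j) ℂ) →
      (∀ P : Submodule ℚ ((K i →+* ℂ) → ℚ), P ≤ antiSpan (ℂ ≃+* ℂ) (Φ i).1 → (∀ g : ℂ ≃+* ℂ, ∀ f ∈ P, (fun x => f (g • x)) ∈ P) →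
        ∀ T : ((K i →+* ℂ) → ℚ) →ₗ[ℚ] ((K j →+* ℂ) → ℚ), (∀ g : ℂ ≃+* ℂ, ∀ f ∈ P, T (fun x => f (g • x)) = fun y => T f (g • y)) →
          (∀ f ∈ P, T f ∈ antiSpan (ℂ ≃+* ℂ) (Φ j).1) → (∀ f ∈ P, T f = 0 → f = 0) → P = ⊥) := by
    intro i j hne hnot
    rcases finrank_eq_or_of_dim_le_three₃₇d hA (h3 i) with hi2 | hi4 | hi6
    · -- `i` a curve: its field embeds in `K_j` only if the blocks agree
      refine (pairwise_of_isEmpty Φ hi2 ⟨fun g => hne ?_⟩).1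
      rcases finrank_eq_or_of_dim_le_three₃₇d hA (h3 j) with hj2 | hj4 | hj6
      · -- two curves with isomorphic fields lie in the same block
        obtain ⟨g'⟩ := nonempty_ringHom_symm_of_finrank_eq g (hi2.trans hj2.symm)
        by_cases h : ∃ t, Module.finrank ℚ (K t) = 6 ∧ Nonempty (K j →+* K t)
        · obtain ⟨t, ht, ⟨f⟩⟩ := h
          rw [hlab j t ht ⟨f⟩, hlab i t ht ⟨f.comp g⟩]
        · have h' : ¬ ∃ t, Module.finrank ℚ (K t) = 6 ∧ Nonempty (K i →+* K t) := fun ⟨t, ht, ⟨f⟩⟩ => h ⟨t, ht, ⟨f.comp g'⟩⟩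
          rw [hlab_none j h, hlab_none i h']
      · exact ((isEmpty_ringHom_curve_simpleSurface hA hi2 hj4 (hS j)).false g).elim
      · exact ((hcurve i j hne hi2 hj6).false g).elim
    · rcases finrank_eq_or_of_dim_le_three₃₇d hA (h3 j) with hj2 | hj4 | hj6
      · exact (pairwise_of_isEmpty Φ hj2 (isEmpty_ringHom_curve_simpleSurface hA hj2 hi4 (hS i))).2
      · -- two surfaces lie in the same block
        exfalso
        apply hne
        have hi' : ¬ ∃ t, Module.finrank ℚ (K t) = 6 ∧ Nonempty (K i →+* K t) := fun ⟨t, ht, ⟨f⟩⟩ => by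
          have hd := finrank_dvd_of_ringHom₃₇d f; rw [hi4, ht] at hd; omega
        have hj' : ¬ ∃ t, Module.finrank ℚ (K t) = 6 ∧ Nonempty (K j →+* K t) := fun ⟨t, ht, ⟨f⟩⟩ => by
          have hd := finrank_dvd_of_ringHom₃₇d f; rw [hj4, ht] at hd; omega
        rw [hlab_none i hi', hlab_none j hj']
      · exact (pairwise_simple_dim_le_three_of_normalClosure_ne hA hS h3 (fun h => not_normalClosure_le_of_sextic_of_quartic hi4 hj6 h.symm.le)
          (not_exists_quadratic_subfield_of_simpleSurface hA hi4 (hS i) j) (not_exists_quadratic_ringHom_of_simpleSurface hA hi4 (hS i) j)).1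
    · rcases finrank_eq_or_of_dim_le_three₃₇d hA (h3 j) with hj2 | hj4 | hj6
      · exact (pairwise_of_isEmpty Φ hj2 (hcurve j i (Ne.symm hne) hj2 hi6)).2
      · exact (pairwise_simple_dim_le_three_of_normalClosure_ne hA hS h3 (fun h => not_normalClosure_le_of_sextic_of_quartic hj4 hi6 h.le)
          (not_exists_quadratic_ringHom_of_simpleSurface hA hj4 (hS j) i) (not_exists_quadratic_subfield_of_simpleSurface hA hj4 (hS j) i)).1
      · -- two sextic slots of different blocks: no sharing either way; the closures differ since `hnot`
        have hL : normalClosure ℚ (K i) ℂ ≠ normalClosure ℚ (K j) ℂ := fun h => hnot ⟨hi6, hj6, h⟩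
        have hno : ¬ Sh i j := fun h => hnotR i j hne hi6 hj6 ⟨hi6, hj6, Or.inr h⟩
        have hno' : ¬ Sh j i := fun h => hnotR j i (Ne.symm hne) hj6 hi6 ⟨hj6, hi6, Or.inr h⟩
        exact (pairwise_simple_dim_le_three_of_normalClosure_ne hA hS h3 hL hno hno').1
  -- two R-related slots share as soon as one of them has an imaginary quadratic subfield
  have hSh_of_R : ∀ t t', R t t' → (∃ F : IntermediateField ℚ (K t), Module.finrank ℚ F = 2 ∧ IsTotallyComplex F) → Sh t t' := by
    rintro t t' ⟨-, -, hg | hsh⟩ ⟨F, hF2, hFtc⟩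
    · obtain ⟨g⟩ := hg
      exact ⟨F, hF2, hFtc, ⟨g.comp (algebraMap F (K t))⟩⟩
    · exact hsh
  -- across blocks, sextic slots with no common constituent-free certificate have one closure
  have hsameL : ∀ i j, lab i ≠ lab j → Module.finrank ℚ (K i) = 6 → Module.finrank ℚ (K j) = 6 →
      ¬ (∀ P : Submodule ℚ ((K i →+* ℂ) → ℚ), P ≤ antiSpan (ℂ ≃+* ℂ) (Φ i).1 → (∀ g : ℂ ≃+* ℂ, ∀ f ∈ P, (fun x => f (g • x)) ∈ P) →
        ∀ T : ((K i →+* ℂ) → ℚ) →ₗ[ℚ] ((K j →+* ℂ) → ℚ), (∀ g : ℂ ≃+* ℂ, ∀ f ∈ P, T (fun x => f (g • x)) = fun y => T f (g • y)) →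
          (∀ f ∈ P, T f ∈ antiSpan (ℂ ≃+* ℂ) (Φ j).1) → (∀ f ∈ P, T f = 0 → f = 0) → P = ⊥) →
      normalClosure ℚ (K i) ℂ = normalClosure ℚ (K j) ℂ := fun i j hne hi hj hnot => by
    by_contra hL
    exact hnot (hpair i j hne fun h => hL h.2.2)
  refine hodgeConjectureFor_prod_of_blocks_of_nondegenerate_sets hA κ hκ (fun J hJ2 hsh => ?_) (fun d M ρ hρ => ?_) π
  · -- the exceptional sets: sextic slots with one closure, pairwise not sharing, at most one per k-group — nondegenerate by the census
    obtain ⟨a₀, ha₀, b₀, hb₀, hab₀⟩ := hJ2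
    have hlab₀ : lab a₀ ≠ lab b₀ := (hκne a₀ b₀).1 hab₀
    have hpart : ∀ i ∈ J, ∃ j ∈ J, lab i ≠ lab j := fun i hi => by
      by_cases h : lab i = lab a₀
      · exact ⟨b₀, hb₀, fun h' => hlab₀ (h.symm.trans h')⟩
      · exact ⟨a₀, ha₀, h⟩
    have h6J : ∀ i ∈ J, Module.finrank ℚ (K i) = 6 := by
      intro i hi
      obtain ⟨j, hj, hne⟩ := hpart i hi
      have hij : i ≠ j := fun h => hne (by rw [h])
      by_contra hi6
      exact hsh i hi j hj hij (hpair i j hne fun h => hi6 h.1)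
    -- two members of different blocks have one closure; two members of one block have isomorphic fields WITHOUT imaginary quadratic subfield
    have hnoK : ∀ i ∈ J, ∀ i' ∈ J, i ≠ i' → lab i = lab i' → ¬ ∃ F : IntermediateField ℚ (K i), Module.finrank ℚ F = 2 ∧ IsTotallyComplex F := by
      intro i hi i' hi' hii' hlab hF
      obtain ⟨j, hj, hne⟩ := hpart i hi
      have hne' : lab i' ≠ lab j := fun h => hne (hlab.trans h)
      have hij : i ≠ j := fun h => hne (by rw [h])
      have hi'j : i' ≠ j := fun h => hne' (by rw [h])
      have hL₁ := hsameL i j hne (h6J i hi) (h6J j hj) (hsh i hi j hj hij)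
      have hL₂ := hsameL i' j hne' (h6J i' hi') (h6J j hj) (hsh i' hi' j hj hi'j)
      have hR : R i i' := by
        have h := (hlab6 i (h6J i hi)).symm.trans (hlab.trans (hlab6 i' (h6J i' hi')))
        exact (hcls i i' (h6J i hi)).1 (Option.some.inj h)
      rcases hQ i i' hii' (h6J i hi) (h6J i' hi') (hSh_of_R i i' hR hF) with hne_iso | hisol
      · exact normalClosure_ne_of_sharedQuadratic_of_isEmpty_ringEquiv (h6J i hi) (h6J i' hi') (hSh_of_R i i' hR hF) hne_iso (hL₁.trans hL₂.symm)
      · exact (hisol j (h6J j hj) hij.symm hi'j.symm).2 hL₁.symm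
    let S : Type := {l : I // l ∈ J}
    haveI : Nonempty S := ⟨⟨a₀, ha₀⟩⟩
    have hniso : ∀ a b : S, a ≠ b → ¬ AbelianVariety.IsIsogenous (A a.1) (A b.1) := fun a b hab =>
      hN a.1 b.1 (fun h => hab (Subtype.ext h)) (h6J a.1 a.2) (h6J b.1 b.2)
    refine (isNondegenerateFamily_simpleFamily_dim_le_three_iff (K := fun l : S => K l.1) (Φ := fun l : S => Φ l.1) (A := fun l : S => A l.1)
      (fun l => hA l.1) (fun l => hS l.1) hniso (fun l => h3 l.1)).2 ⟨?_, ?_, ?_⟩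
    · -- (i) no sharing inside `J`
      intro a b hab hshab
      have hab' : a.1 ≠ b.1 := fun h => hab (Subtype.ext h)
      have hshab' : Sh a.1 b.1 := hshab
      by_cases hlab : lab a.1 = lab b.1
      · obtain ⟨F, hF2, hFtc, -⟩ := hshab'
        exact hnoK a.1 a.2 b.1 b.2 hab' hlab ⟨F, hF2, hFtc⟩
      · exact hnotR a.1 b.1 hlab (h6J a.1 a.2) (h6J b.1 b.2) ⟨h6J a.1 a.2, h6J b.1 b.2, Or.inr hshab'⟩
    · -- (ii) at most three isomorphic fields
      intro a _
      have h := Finset.card_le_card_of_injOn (s := (Finset.univ.filter fun b : S => Nonempty (K b.1 ≃+* K a.1)))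
        (t := Finset.univ.filter fun t' => Nonempty (K t' ≃+* K a.1)) (fun b : S => b.1)
        (fun b hb => by
          have hb' := (Finset.mem_filter.1 (Finset.mem_coe.1 hb)).2
          exact Finset.mem_coe.2 (Finset.mem_filter.2 ⟨Finset.mem_univ _, hb'⟩))
        (fun b _ b' _ hbb => Subtype.ext hbb)
      exact h.trans (hB3 a.1 (h6J a.1 a.2))
    · -- (iii) vacuous: all members are sextic
      intro a ha4
      have := h6J a.1 a.2
      omega
  · -- the Hodge conjecture inside the block `d`
    obtain ⟨o, i₀, hi₀⟩ := d
    have hρ' : ∀ l, lab (ρ l) = o := fun l => by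
      have h := congrArg Subtype.val (hρ l)
      exact h
    cases M with
    | zero => exact hodgeConjectureFor_of_isDivisorGenerated _ (isDivisorGenerated_of_dim_eq_zero _ (dim_biproduct_fin_zero _))
    | succ M =>
      rcases o with _ | c
      · -- the block of surfaces and free curves
        refine hodgeConjectureFor_prod_surfaceBlock_of_closures hA hS h3 hS3 ρ fun l h6 => ?_
        have h := hρ' l
        rw [hlab6 (ρ l) h6] at h
        exact Option.some_ne_none _ h
      · -- a block of threefolds and their curves: `c = cls t₀` for a sextic `t₀`
        obtain ⟨t₀, ht₀, hc⟩ : ∃ t₀, Module.finrank ℚ (K t₀) = 6 ∧ lab (ρ 0) = some (cls t₀) := by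
          by_cases h : ∃ t, Module.finrank ℚ (K t) = 6 ∧ Nonempty (K (ρ 0) →+* K t)
          · obtain ⟨t, ht, hg⟩ := h
            exact ⟨t, ht, hlab _ t ht hg⟩
          · exact absurd ((hlab_none _ h).symm.trans (hρ' 0)) (by simp)
        have hco : some (cls t₀) = some c := hc.symm.trans (hρ' 0)
        -- every member: a curve through a field of the class, or a sextic slot of the class
        have hmem : ∀ l, (Module.finrank ℚ (K (ρ l)) = 2 ∧ ∃ t, Module.finrank ℚ (K t) = 6 ∧ Nonempty (K (ρ l) →+* K t) ∧ R t₀ t) ∨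
            (Module.finrank ℚ (K (ρ l)) = 6 ∧ R t₀ (ρ l)) := by
          intro l
          have hl : lab (ρ l) = some (cls t₀) := (hρ' l).trans hco.symm
          by_cases h : ∃ t, Module.finrank ℚ (K t) = 6 ∧ Nonempty (K (ρ l) →+* K t)
          · obtain ⟨t, ht, hg⟩ := h
            have hct : cls t = cls t₀ := by
              have h1 := (hlab _ t ht hg).symm.trans hl
              exact Option.some.inj h1
            have hRt : R t₀ t := hRsymm _ _ ((hcls t t₀ ht).1 hct)
            rcases finrank_eq_or_of_dim_le_three₃₇d hA (h3 (ρ l)) with h2 | h4 | h6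
            · exact Or.inl ⟨h2, t, ht, hg, hRt⟩
            · exfalso
              obtain ⟨g⟩ := hg
              have hd := finrank_dvd_of_ringHom₃₇d g; rw [h4, ht] at hd; omega
            · refine Or.inr ⟨h6, hRtrans _ _ _ hRt (hRsymm _ _ ⟨h6, ht, Or.inl hg⟩)⟩
          · exact absurd ((hlab_none _ h).symm.trans hl) (by simp)
        by_cases hK : ∃ F : IntermediateField ℚ (K t₀), Module.finrank ℚ F = 2 ∧ IsTotallyComplex F
        · -- (ii) a GROUP through the imaginary quadratic field `F₀ ≤ K_{t₀}`
          obtain ⟨F₀, hF₀2, hF₀tc⟩ := hK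
          haveI : IsTotallyComplex F₀ := hF₀tc
          haveI : IsCMField F₀ := isCMField_of_isTotallyComplex_of_finrank_two hF₀2
          let s : Finset I := Finset.univ.filter fun t => R t₀ t
          let e : Fin s.card → I := fun m => (s.equivFin.symm m).1
          have he_mem : ∀ m, R t₀ (e m) := fun m => (Finset.mem_filter.1 (s.equivFin.symm m).2).2
          have he_inj : Function.Injective e := fun m m' h => s.equivFin.symm.injective (Subtype.ext h)
          have he_surj : ∀ t, R t₀ t → ∃ m, t = e m := fun t ht =>
            ⟨s.equivFin ⟨t, Finset.mem_filter.2 ⟨Finset.mem_univ _, ht⟩⟩, by simp only [e, Equiv.symm_apply_apply]⟩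
          -- `F₀` embeds in every field of the class
          have hF₀emb : ∀ t, R t₀ t → Nonempty (F₀ →+* K t) := by
            rintro t ⟨-, -, hg | hsh⟩
            · obtain ⟨g⟩ := hg
              exact ⟨g.comp (algebraMap F₀ (K t₀))⟩
            · exact nonempty_ringHom_of_sharedQuadratic (h46 t₀ ht₀) F₀ hF₀2 hsh
          let i : ∀ m, F₀ →+* K (e m) := fun m => Classical.choice (hF₀emb _ (he_mem m))
          obtain ⟨τ⟩ : Nonempty (F₀ →+* ℂ) := inferInstance
          by_cases hip : ∃ u u' : I, R t₀ u ∧ R t₀ u' ∧ u ≠ u' ∧ Nonempty (K u' ≃+* K u)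
          · -- (ii-b) an ISOMORPHIC pair in the class: by (A₂) it is isolated, so the class is the pair — the PAIR BLOCK
            obtain ⟨u, u', hRu, hRu', huu', ⟨ε⟩⟩ := hip
            obtain ⟨gu⟩ := hF₀emb u hRu
            obtain ⟨gu'⟩ := hF₀emb u' hRu'
            have hisol := (hQ u u' huu' hRu.2.1 hRu'.2.1 (exists_quadratic_subfield_of_ringHom_ringHom hF₀2 gu gu')).resolve_left fun h => h.false ε
            have hcls2 : ∀ t, R t₀ t → t = u ∨ t = u' := fun t hRt => by
              by_contra hno
              push Not at hno
              obtain ⟨gt⟩ := hF₀emb t hRt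
              exact (hisol t hRt.2.1 hno.1 hno.2).1 (exists_quadratic_subfield_of_ringHom_ringHom hF₀2 gu gt)
            refine hodgeConjectureFor_prod_pairBlock_of_markman hW4 hA hS u u' hRu.2.1 hRu'.2.1 hF₀2 gu gu' ρ fun l => ?_
            rcases hmem l with ⟨h2, t, -, hg, hRt⟩ | ⟨-, hRl⟩
            · rcases hcls2 t hRt with rfl | rfl
              exacts [Or.inl ⟨h2, Or.inl hg⟩, Or.inl ⟨h2, Or.inr hg⟩]
            · exact Or.inr (hcls2 (ρ l) hRl)
          · -- (ii-a) pairwise non-isomorphic fields inside the class: W2's group block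
            have hiso : ∀ m₀ m : Fin s.card, m₀ ≠ m → IsEmpty (K (e m) →+* K (e m₀)) := by
              intro m₀ m hm
              refine ⟨fun g => hip ⟨e m₀, e m, he_mem m₀, he_mem m, fun h => hm (he_inj h), ?_⟩⟩
              exact nonempty_ringEquiv_of_ringHom_of_finrank_eq g ((he_mem m).2.1.trans (he_mem m₀).2.1.symm)
            refine hodgeConjectureFor_prod_groupBlock_of_isEmpty_ringHom hW4 hA hS e (fun m => (he_mem m).2.1) hF₀2 i τ hiso ρ fun l => ?_
            rcases hmem l with ⟨h2, t, ht, hg, hRt⟩ | ⟨h6, hRl⟩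
            · obtain ⟨m, rfl⟩ := he_surj t hRt
              exact Or.inl ⟨h2, m, hg⟩
            · exact Or.inr (he_surj (ρ l) hRl)
        · -- (i) an isomorphism class of fields WITHOUT imaginary quadratic subfield: nondegenerate by the census, no curve
          have hiso_of_R : ∀ t, R t₀ t → Nonempty (K t₀ →+* K t) := by
            rintro t ⟨-, -, hg | hsh⟩
            · exact hg
            · obtain ⟨F, hF2, hFtc, -⟩ := hsh
              exact absurd ⟨F, hF2, hFtc⟩ hK
          have hnoK' : ∀ t, R t₀ t → ¬ ∃ F : IntermediateField ℚ (K t), Module.finrank ℚ F = 2 ∧ IsTotallyComplex F := by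
            rintro t hRt ⟨F, hF2, hFtc⟩
            obtain ⟨F', hF'2, hF'tc, ⟨g⟩⟩ := hSh_of_R t t₀ (hRsymm _ _ hRt) ⟨F, hF2, hFtc⟩
            haveI : IsTotallyComplex F' := hF'tc
            obtain ⟨F'', hF''2, hF''tc, -⟩ := exists_quadratic_subfield_of_ringHom_ringHom (k := F') hF'2 g g
            exact hK ⟨F'', hF''2, hF''tc⟩
          -- the members are sextic slots of the class
          have hmem6 : ∀ l, Module.finrank ℚ (K (ρ l)) = 6 ∧ R t₀ (ρ l) := fun l => by
            rcases hmem l with ⟨h2, t, ht, ⟨g⟩, hRt⟩ | h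
            · exfalso
              obtain ⟨g₀⟩ := hiso_of_R t hRt
              obtain ⟨g₀'⟩ := nonempty_ringHom_symm_of_finrank_eq g₀ (ht₀.trans ht.symm)
              obtain ⟨F, hF2, hFtc, -⟩ := exists_quadratic_subfield_of_ringHom_ringHom (k := K (ρ l)) h2 (g₀'.comp g) (g₀'.comp g)
              exact hK ⟨F, hF2, hFtc⟩
            · exact h
          -- the class sub-family is nondegenerate
          let S : Type := {t : I // R t₀ t}
          haveI : Nonempty S := ⟨⟨t₀, hRrefl t₀ ht₀⟩⟩
          have hniso : ∀ a b : S, a ≠ b → ¬ AbelianVariety.IsIsogenous (A a.1) (A b.1) := fun a b hab =>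
            hN a.1 b.1 (fun h => hab (Subtype.ext h)) a.2.2.1 b.2.2.1
          have hnd : CMAlgebra.IsNondegenerateFamily (fun t : S => Φ t.1) := by
            refine (isNondegenerateFamily_simpleFamily_dim_le_three_iff (K := fun l : S => K l.1) (Φ := fun l : S => Φ l.1) (A := fun l : S => A l.1)
              (fun l => hA l.1) (fun l => hS l.1) hniso (fun l => h3 l.1)).2 ⟨?_, ?_, ?_⟩
            · intro a b _ hshab
              obtain ⟨F, hF2, hFtc, -⟩ := hshab
              exact hnoK' a.1 a.2 ⟨F, hF2, hFtc⟩
            · intro a _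
              have h := Finset.card_le_card_of_injOn (s := (Finset.univ.filter fun b : S => Nonempty (K b.1 ≃+* K a.1)))
                (t := Finset.univ.filter fun t' => Nonempty (K t' ≃+* K a.1)) (fun b : S => b.1)
                (fun b hb => by
                  have hb' := (Finset.mem_filter.1 (Finset.mem_coe.1 hb)).2
                  exact Finset.mem_coe.2 (Finset.mem_filter.2 ⟨Finset.mem_univ _, hb'⟩))
                (fun b _ b' _ hbb => Subtype.ext hbb)
              exact h.trans (hB3 a.1 a.2.2.1)
            · intro a ha4
              have := a.2.2.1
              omega
          exact hnd.hodgeConjectureFor_prod (A := fun t : S => A t.1) (fun t => hA t.1) fun l => (⟨ρ l, (hmem6 l).2⟩ : S)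

/-- **Dominated form.** [cite: MoonenZarhin1999LowDim, Thm. (0.1), (0.2)] [cite: Markman2025SurveySecant, Thm. 1.2] [cite: MumfordAV1970, §19 Thm. 1 and p. 169] -/
theorem hodgeConjectureFor_of_avDominatedBy_prod_of_twoPerIsolatedField_of_markman [Fintype I] (hW4 : Markman2025_weilClasses_algebraic_abelianFourfold)
    (hA : ∀ i, IsCMTypeRealisation (Φ i) (A i) (ι i) (θ i)) (hS : ∀ i, (A i).IsSimple) (h3 : ∀ i, (A i).dim ≤ 3)
    (hQ : ∀ t t' : I, t ≠ t' → Module.finrank ℚ (K t) = 6 → Module.finrank ℚ (K t') = 6 →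
      (∃ F : IntermediateField ℚ (K t), Module.finrank ℚ F = 2 ∧ IsTotallyComplex F ∧ Nonempty (F →+* K t')) → IsEmpty (K t' ≃+* K t) ∨
        ∀ t'' : I, Module.finrank ℚ (K t'') = 6 → t'' ≠ t → t'' ≠ t' →
          (¬ ∃ F : IntermediateField ℚ (K t), Module.finrank ℚ F = 2 ∧ IsTotallyComplex F ∧ Nonempty (F →+* K t'')) ∧ normalClosure ℚ (K t'') ℂ ≠ normalClosure ℚ (K t) ℂ)
    (hN : ∀ t t' : I, t ≠ t' → Module.finrank ℚ (K t) = 6 → Module.finrank ℚ (K t') = 6 → ¬ AbelianVariety.IsIsogenous (A t) (A t'))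
    (hB3 : ∀ t : I, Module.finrank ℚ (K t) = 6 → (Finset.univ.filter fun t' => Nonempty (K t' ≃+* K t)).card ≤ 3)
    (hS3 : ∀ x y z : I, Module.finrank ℚ (K x) = 4 → Module.finrank ℚ (K y) = 4 → Module.finrank ℚ (K z) = 4 →
      normalClosure ℚ (K x) ℂ = normalClosure ℚ (K y) ℂ → normalClosure ℚ (K y) ℂ = normalClosure ℚ (K z) ℂ →
      AbelianVariety.IsIsogenous (A x) (A y) ∨ AbelianVariety.IsIsogenous (A x) (A z) ∨ AbelianVariety.IsIsogenous (A y) (A z))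
    {N : ℕ} (π : Fin N → I) {X : AbelianVariety ℂ} (hX : Domination.AVDominatedBy X (⨁ fun j => A (π j))) : HodgeConjectureFor X.dim X.X :=
  Domination.hodgeConjectureFor_of_avDominatedBy (hodgeConjectureFor_prod_of_twoPerIsolatedField_of_markman hW4 hA hS h3 hQ hN hB3 hS3 π) hX

end Summit.HodgeConjecture.CorCM.MultiFieldWeil

end
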